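import Summits.Ventures.HSemireg.WedgeKunneth
import Summits.Ventures.HSemireg.WedgePairRank
import Summits.Ventures.HSemireg.FormulaNUniform

/-!
# Venture HSemireg — FORMULA-N uniformly in `n` AND in the factor dimension `m`: the rank polynomial of the `n`-fold box
# `f₁ ∧ ⋯ ∧ f_n` of `m`-dimensional point pairs is `P_m(t)ⁿ`, `P_m = 2(1+t)^m − 1 − t^m` — th-7's THEOREM T and Künneth law ITERATED

HONEST FRAMING. Part of the Lean index of the computation cell `pub-hsemireg` (seat p10 gen 3, Sunday typer «UNIFORM-IN-n»).
Finite-dimensional EXTERIOR ALGEBRA over a field ONLY: no variety, no cohomology theory, no sheaf, no semiregularity map is constructed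
here; nothing here says that HC / HC_CM / HC_AV holds; no Literature fact is declared or used.  Custodian versions: STRUCTURE.md
v1.0-SIGNED 9b196a05977dd067 (§1.1 C10; FORMULA-N Σ2 «rank polynomials multiply»), theory/FORMULA-N.md PART A §2.2–2.3 (th-6), PART B
§E / §N.7 (th-7: «surface powers (1+4t+t²)ⁿ by iteration»).

p10 gen 2 typed the SURFACE case (`m = 2`, `WedgeSurfacePowers.lean`: `(1 + 4t + t²)ⁿ`) and p10 gen 0 the TWO-FACTOR case (`n = 2`,
`FormulaNUniform.boxRank = [t^k]P_m²`).  THIS FILE does both parameters at once, by the same two tree theorems (th-7's THEOREM T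
`WedgePair.finrank_range_wedgeMap_pointPair` for ONE `m`-dimensional point pair, and th-7's Künneth law `Wedge.Kunneth.rankPoly_mul` /
`finrank_V_emb`, iterated over `n` blocks of `2m` generators):
* the model: `n·(m+m)` generators `Fin ((m+m)·n)` in `n` blocks `D i`; on block `i` the point pair `f_i = a·E_{X_i} + c·E_{Y_i}`
  (`X_i`, `Y_i` the two halves; `WedgePair.pointPair K m a c` embedded along the order embedding `Fin (m+m) ↪o Fin ((m+m)n)`);
* `pairPoly m` (over `ℕ`): coefficients `WedgePair.pointPairRank m k = 2C(m,k) − [k=0] − [k=m]` for `k ≤ m`, `0` above;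
  `rankPoly_pfac`: it IS the factor's rank polynomial (`a, c ≠ 0`, `m ≥ 1`);
* **`rankPoly_pairBox`**: the rank polynomial of `F = f₀ ∧ ⋯ ∧ f_{n−1}` is `(pairPoly m)ⁿ` (`n ≥ 1`); **`finrank_range_pairBox`**:
  `rank(θ ↦ θ ∧ F ∣ ⋀^k K^{(m+m)n}) = [t^k] (pairPoly m)ⁿ` for every `k`; in `ℤ[X]`: `= [t^k] P_mⁿ` with th-6's `FormulaN.Uniform.P m`
  (`…_eq_coeff_P_pow`), so `n = 2` gives back `boxRank m k` (`…_two_eq_boxRank`) and `m = 2` the surface powers.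
DICTIONARY (quoted, NOT asserted; th-7 PART B §A.3): block `i` ↔ the `i`-th `m`-dimensional factor, `X_i ↔ H⁰(T)`-, `Y_i ↔ H¹(𝒪)`-type
directions in the spinor presentation, `f_i ↔ ch` of a point-pair object (`a·1 + c·pt`), `θ ↦ θ ∧ F ↔ ⌟ch(F)`; the Ext side stays on
paper / by value.  Namespace `Summit.Ventures.HSemireg.Wedge.PairPowers` (new).
-/

open Module Set Set.powersetCard Polynomial

namespace Summit.Ventures.HSemireg.Wedge.PairPowers

open Summit.Ventures.HSemireg.Wedge Summit.Ventures.HSemireg.Wedge.Kunneth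

variable (K : Type*) [Field K] (m : ℕ)

/-! ## §1. One `m`-dimensional point pair: rank polynomial `pairPoly m` -/

/-- th-7's point pair `a·E_X + c·E_Y` on `2m` generators, in the generic wedge model (same exterior algebra `⋀ K^{2m}`). -/
noncomputable def pp (a c : K) : HT K (Fin (m + m)) := WedgePair.pointPair K m a c

/-- th-7's two monomial bases agree. -/
lemma B_pair_eq (s : Finset (Fin (m + m))) : WedgePair.B K m s = B K (Fin (m + m)) s := rfl

/-- the point pair is homogeneous of degree `m`. -/
lemma pp_mem_Hom (a c : K) : pp K m a c ∈ Hom K (Fin (m + m)) Finset.univ m := by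
  unfold pp WedgePair.pointPair
  refine Submodule.add_mem _ (Submodule.smul_mem _ _ ?_) (Submodule.smul_mem _ _ ?_)
  · rw [WedgePair.coe_Xpc, B_pair_eq]
    exact B_mem_Hom K (Finset.subset_univ _) (WedgePair.card_Xset m)
  · rw [WedgePair.coe_Ypc, B_pair_eq]
    exact B_mem_Hom K (Finset.subset_univ _) (WedgePair.card_Yset m)

variable {m}

/-- in degrees `> m` the point pair kills everything (a set of more than `m` letters meets both halves). -/
lemma range_wedge_pp_eq_bot {k : ℕ} (hk : m < k) (a c : K) : LinearMap.range (wedge K (Fin (m + m)) k (pp K m a c)) = ⊥ := by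
  rw [show wedge K (Fin (m + m)) k (pp K m a c) = WedgePair.wedgeMap K m k (WedgePair.pointPair K m a c) from rfl,
    WedgePair.range_wedgeMap, Submodule.span_eq_bot]
  rintro _ ⟨s, rfl⟩
  have hX : ¬ Disjoint s.val (WedgePair.Xpc m).val := fun h => by
    have h1 := Finset.card_le_card (WedgePair.disjoint_X_iff_subset_Y.mp h)
    rw [card_eq s, WedgePair.card_Yset] at h1
    omega
  have hY : ¬ Disjoint s.val (WedgePair.Ypc m).val := fun h => by
    have h1 := Finset.card_le_card (WedgePair.disjoint_Y_iff_subset_X.mp h)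
    rw [card_eq s, WedgePair.card_Xset] at h1
    omega
  show WedgePair.B K m s * WedgePair.pointPair K m a c = 0
  rw [WedgePair.B_mul_pointPair, WedgePair.B_mul_of_not_disjoint K s _ hX, WedgePair.B_mul_of_not_disjoint K s _ hY,
    smul_zero, smul_zero, add_zero]

variable (m)

/-- the RANK POLYNOMIAL of one `m`-dimensional point pair, over `ℕ`: `Σ_{k ≤ m} (2C(m,k) − [k=0] − [k=m]) t^k` (`= P_m(t)`). -/
noncomputable def pairPoly : Polynomial ℕ := ∑ k ∈ Finset.range (m + 1), monomial k (WedgePair.pointPairRank m k)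

/-- coefficients of `pairPoly`. -/
lemma coeff_pairPoly (k : ℕ) : (pairPoly m).coeff k = if k ≤ m then WedgePair.pointPairRank m k else 0 := by
  rw [pairPoly, finsetSum_coeff]
  simp_rw [coeff_monomial]
  rw [Finset.sum_ite_eq']
  exact if_congr (by rw [Finset.mem_range]; exact Nat.lt_succ_iff) rfl rfl

/-- `pairPoly m` is th-6's `P_m = 2(1+t)^m − 1 − t^m` (coefficientwise in `ℤ`). -/
theorem coeff_pairPoly_cast (k : ℕ) : ((pairPoly m).coeff k : ℤ) = (FormulaN.Uniform.P m).coeff k := by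
  rw [coeff_pairPoly, FormulaN.Uniform.coeff_P, show FormulaN.transversePairRank m k = WedgePair.pointPairRank m k from rfl]
  split_ifs with h
  · rfl
  · rw [WedgePair.pointPairRank, Nat.choose_eq_zero_of_lt (by omega)]
    simp

/-! ## §2. `n` blocks of `2m` generators inside `Fin ((m+m)·n)` -/

variable (n : ℕ)

/-- the order embedding of block `i`: `j ↦ (m+m)·i + j`. -/
def blockEmb (i : Fin n) : Fin (m + m) ↪o Fin ((m + m) * n) :=
  OrderEmbedding.ofStrictMono (fun j => ⟨(m + m) * i + j, by have := i.2; have := j.2; nlinarith⟩)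
    (fun j j' h => by rw [Fin.lt_def] at h ⊢; simp only; omega)

/-- the value of the block embedding. -/
@[simp] lemma blockEmb_val (i : Fin n) (j : Fin (m + m)) : ((blockEmb m n i j : Fin ((m + m) * n)) : ℕ) = (m + m) * i + j := rfl

/-- block `i`: the generators `(m+m)i, …, (m+m)i + 2m − 1`. -/
def D (i : Fin n) : Finset (Fin ((m + m) * n)) := Finset.univ.map (blockEmb m n i).toEmbedding

/-- membership in block `i` by value. -/
lemma mem_D {i : Fin n} {x : Fin ((m + m) * n)} : x ∈ D m n i ↔ (m + m) * (i : ℕ) ≤ x ∧ (x : ℕ) < (m + m) * i + (m + m) := by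
  rw [D, Finset.mem_map]
  constructor
  · rintro ⟨j, -, rfl⟩
    have := j.2
    simp only [RelEmbedding.coe_toEmbedding, blockEmb_val]
    omega
  · rintro ⟨h1, h2⟩
    refine ⟨⟨x - (m + m) * i, by omega⟩, Finset.mem_univ _, Fin.ext ?_⟩
    simp only [RelEmbedding.coe_toEmbedding, blockEmb_val]
    omega

/-- the first `j` blocks: generators `< (m+m)j`. -/
def U (j : ℕ) : Finset (Fin ((m + m) * n)) := Finset.univ.filter fun x => (x : ℕ) < (m + m) * j

/-- membership in `U j`. -/
lemma mem_U {j : ℕ} {x : Fin ((m + m) * n)} : x ∈ U m n j ↔ (x : ℕ) < (m + m) * j := by simp [U]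

/-- `U (j+1) = U j ⊔ D j`. -/
lemma U_succ {j : ℕ} (hj : j < n) : U m n (j + 1) = U m n j ∪ D m n ⟨j, hj⟩ := by
  ext x
  rw [Finset.mem_union, mem_U, mem_U, mem_D]
  simp only
  constructor
  · intro h
    by_cases h' : (x : ℕ) < (m + m) * j
    · exact Or.inl h'
    · right; constructor <;> nlinarith
  · rintro (h | ⟨h1, h2⟩) <;> nlinarith

/-- `U j` and block `j` are disjoint. -/
lemma disjoint_U_D {j : ℕ} (hj : j < n) : Disjoint (U m n j) (D m n ⟨j, hj⟩) := by
  rw [Finset.disjoint_left]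
  intro x h1 h2
  rw [mem_U] at h1
  rw [mem_D] at h2
  simp only at h2
  omega

/-- `U 1 = D 0`. -/
lemma U_one (hn : 0 < n) : U m n 1 = D m n ⟨0, hn⟩ := by
  ext x
  rw [mem_U, mem_D]
  simp only
  omega

/-- all `n` blocks cover the generators. -/
lemma U_self : U m n n = Finset.univ := by
  ext x
  simp only [mem_U, Finset.mem_univ, iff_true]
  exact x.2

/-! ## §3. The point-pair factors and their product -/

variable {m n}

/-- the `i`-th point-pair factor `f_i = a·E_{X_i} + c·E_{Y_i}` inside `⋀ K^{(m+m)n}`. -/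
noncomputable def pfac (a c : K) (i : Fin n) : HT K (Fin ((m + m) * n)) := emb K (blockEmb m n i) (pp K m a c)

/-- `f_i` is homogeneous of degree `m`, supported on block `i`. -/
lemma pfac_mem_Hom (a c : K) (i : Fin n) : pfac K (m := m) a c i ∈ Hom K (Fin ((m + m) * n)) (D m n i) m :=
  emb_mem_Hom K (blockEmb m n i) (pp_mem_Hom K m a c)

/-- **the rank polynomial of a point-pair factor is `pairPoly m`** (THEOREM T transported by `finrank_V_emb`; `m ≥ 1`, `a, c ≠ 0`). -/
theorem rankPoly_pfac (hm : 1 ≤ m) {a c : K} (ha : a ≠ 0) (hc : c ≠ 0) (i : Fin n) :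
    rankPoly K (Fin ((m + m) * n)) (D m n i) (pfac K (m := m) a c i) = pairPoly m := by
  ext k
  rw [coeff_rankPoly, D, pfac, finrank_V_emb, coeff_pairPoly]
  split_ifs with hk
  · exact WedgePair.finrank_range_wedgeMap_pointPair K (by omega) hk ha hc
  · rw [range_wedge_pp_eq_bot K (by omega), finrank_bot]

/-- the product of the first `j` factors, `F_j = f₀ ∧ ⋯ ∧ f_{j−1}` (`F_0 = 1`). -/
noncomputable def prodFac (a c : K) : ℕ → HT K (Fin ((m + m) * n))
  | 0 => 1
  | j + 1 => prodFac a c j * (if h : j < n then pfac K (m := m) a c ⟨j, h⟩ else 1)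

/-- the `n`-fold POINT-PAIR BOX `F = f₀ ∧ ⋯ ∧ f_{n−1}` on `⋀ K^{(m+m)n}` (model of `ch` of an `n`-fold box of point-pair objects on
`m`-dimensional factors, sign-blind). -/
noncomputable def pairBox (a c : K) : HT K (Fin ((m + m) * n)) := prodFac K (m := m) (n := n) a c n

/-- the product of the first `j ≥ 1` factors is homogeneous of degree `mj` on `U j`, with rank polynomial `(pairPoly m)^j`. -/
theorem prodFac_spec (hm : 1 ≤ m) {a c : K} (ha : a ≠ 0) (hc : c ≠ 0) :
    ∀ j, 1 ≤ j → j ≤ n →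
      prodFac K (m := m) (n := n) a c j ∈ Hom K (Fin ((m + m) * n)) (U m n j) (m * j) ∧
        rankPoly K (Fin ((m + m) * n)) (U m n j) (prodFac K (m := m) (n := n) a c j) = pairPoly m ^ j := by
  intro j hj1 hjn
  induction j with
  | zero => omega
  | succ j ih =>
    have hj : j < n := by omega
    rcases Nat.eq_zero_or_pos j with rfl | hjpos
    · have e : prodFac K (m := m) (n := n) a c 1 = pfac K a c ⟨0, hj⟩ := by
        show 1 * _ = _
        rw [one_mul, dif_pos hj]
      rw [e, U_one m n hj, pow_one, show m * (0 + 1) = m by ring]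
      exact ⟨pfac_mem_Hom K a c _, rankPoly_pfac K hm ha hc _⟩
    · obtain ⟨hHom, hPoly⟩ := ih hjpos (by omega)
      have e : prodFac K (m := m) (n := n) a c (j + 1) = prodFac K (m := m) (n := n) a c j * pfac K a c ⟨j, hj⟩ := by
        show _ * _ = _
        rw [dif_pos hj]
      rw [e, U_succ m n hj]
      refine ⟨?_, ?_⟩
      · have := mul_mem_Hom K (disjoint_U_D m n hj) hHom (pfac_mem_Hom K a c ⟨j, hj⟩)
        rwa [show m * j + m = m * (j + 1) by ring] at this
      · rw [rankPoly_mul K (disjoint_U_D m n hj) hHom (pfac_mem_Hom K a c ⟨j, hj⟩), hPoly, rankPoly_pfac K hm ha hc, pow_succ]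

/-- **THE RANK POLYNOMIAL OF THE `n`-FOLD POINT-PAIR BOX IS `P_m(t)ⁿ`** (`m, n ≥ 1`): FORMULA-N Σ2 «rank polynomials multiply», iterated. -/
theorem rankPoly_pairBox (hm : 1 ≤ m) (hn : 1 ≤ n) {a c : K} (ha : a ≠ 0) (hc : c ≠ 0) :
    rankPoly K (Fin ((m + m) * n)) Finset.univ (pairBox K (m := m) (n := n) a c) = pairPoly m ^ n := by
  rw [← U_self m n]
  exact ((prodFac_spec K hm ha hc) n hn le_rfl).2

/-- **`rank(θ ↦ θ ∧ F ∣ ⋀^k K^{(m+m)n}) = [t^k] (pairPoly m)ⁿ`** for every `k` (`m, n ≥ 1`). -/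
theorem finrank_range_pairBox (hm : 1 ≤ m) (hn : 1 ≤ n) {a c : K} (ha : a ≠ 0) (hc : c ≠ 0) (k : ℕ) :
    finrank K (LinearMap.range (wedge K (Fin ((m + m) * n)) k (pairBox K (m := m) (n := n) a c))) = (pairPoly m ^ n).coeff k := by
  rw [← V_univ, ← coeff_rankPoly, rankPoly_pairBox K hm hn ha hc]

/-- the same in `ℤ[X]` with th-6's `P_m`: **`rank = [t^k] P_m(t)ⁿ`**. -/
theorem finrank_range_pairBox_eq_coeff_P_pow (hm : 1 ≤ m) (hn : 1 ≤ n) {a c : K} (ha : a ≠ 0) (hc : c ≠ 0) (k : ℕ) :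
    (finrank K (LinearMap.range (wedge K (Fin ((m + m) * n)) k (pairBox K (m := m) (n := n) a c))) : ℤ) =
      (FormulaN.Uniform.P m ^ n).coeff k := by
  rw [finrank_range_pairBox K hm hn ha hc]
  have h : (pairPoly m).map (Nat.castRingHom ℤ) = FormulaN.Uniform.P m := by
    ext j
    rw [coeff_map, eq_natCast, coeff_pairPoly_cast]
  rw [← h, ← Polynomial.map_pow, coeff_map, eq_natCast]

/-- **EDGE `n = 2`**: the two-factor box of `m`-dimensional point pairs has rank `R_k(m) = boxRank m k = [t^k]P_m²` (p10 gen 0's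
`FormulaN.Uniform.boxRank`, there typed in th-7's `WedgeBox` model; here in the iterated model, `m ≥ 1`). -/
theorem finrank_range_pairBox_two_eq_boxRank (hm : 1 ≤ m) {a c : K} (ha : a ≠ 0) (hc : c ≠ 0) (k : ℕ) :
    finrank K (LinearMap.range (wedge K (Fin ((m + m) * 2)) k (pairBox K (m := m) (n := 2) a c))) =
      FormulaN.Uniform.boxRank m k := by
  have h := finrank_range_pairBox_eq_coeff_P_pow K hm (show 1 ≤ 2 by norm_num) ha hc k
  rw [FormulaN.Uniform.coeff_P_sq] at h
  exact_mod_cast h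

/-- **EDGE `m = 2`** (surfaces): `[t⁰..t²] (pairPoly 2)ⁿ`-free sanity: `pairPoly 2` has coefficients `(1, 4, 1)` (= `1 + 4t + t²`,
`WedgeSurfacePowers.surfPoly`). -/
theorem coeff_pairPoly_two : (pairPoly 2).coeff 0 = 1 ∧ (pairPoly 2).coeff 1 = 4 ∧ (pairPoly 2).coeff 2 = 1 ∧ (pairPoly 2).coeff 3 = 0 := by
  simp only [coeff_pairPoly, WedgePair.pointPairRank]
  decide

/-- threefold factors (`m = 3`): `pairPoly 3 = 1 + 6t + 6t² + t³`; the triple box (`n = 3`) has total degree-2 rank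
`[t²](1+6t+6t²+t³)³ = 126` and the double box `48` (the numbers behind the pre-registered per-q rows of `FormulaNPerQUniform.lean`:
`270 = 126 + 3·48`). -/
theorem coeff_pairPoly_three :
    ((pairPoly 3).coeff 0, (pairPoly 3).coeff 1, (pairPoly 3).coeff 2, (pairPoly 3).coeff 3) = (1, 6, 6, 1) ∧
    (pairPoly 3 ^ 3).coeff 2 = 126 ∧ (pairPoly 3 ^ 2).coeff 2 = 48 := by
  have h0 : (pairPoly 3).coeff 0 = 1 := by rw [coeff_pairPoly, WedgePair.pointPairRank]; decide
  have h1 : (pairPoly 3).coeff 1 = 6 := by rw [coeff_pairPoly, WedgePair.pointPairRank]; decide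
  have h2 : (pairPoly 3).coeff 2 = 6 := by rw [coeff_pairPoly, WedgePair.pointPairRank]; decide
  have h3 : (pairPoly 3).coeff 3 = 1 := by rw [coeff_pairPoly, WedgePair.pointPairRank]; decide
  refine ⟨by rw [h0, h1, h2, h3], ?_, ?_⟩
  · rw [pow_succ, pow_two, coeff_mul, Finset.Nat.sum_antidiagonal_eq_sum_range_succ_mk, Finset.sum_range_succ,
      Finset.sum_range_succ, Finset.sum_range_succ, Finset.sum_range_zero, coeff_mul, coeff_mul, coeff_mul,
      Finset.Nat.sum_antidiagonal_eq_sum_range_succ_mk, Finset.Nat.sum_antidiagonal_eq_sum_range_succ_mk,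
      Finset.Nat.sum_antidiagonal_eq_sum_range_succ_mk]
    simp [Finset.sum_range_succ, h0, h1, h2]
  · rw [pow_two, coeff_mul, Finset.Nat.sum_antidiagonal_eq_sum_range_succ_mk]
    simp [Finset.sum_range_succ, h0, h1, h2]

end Summit.Ventures.HSemireg.Wedge.PairPowers
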